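import Summits.ResolutionOfSingularities.ResolutionOfSingularities.Theorems.FactorCutKernels
import HarnessLib

/-!
# FactorCutKernels2 — decomp-res node «FactorCut» (lens-4 g33, critic row 191 CLEARED +1), tree file 2/5 of the node

Content VERBATIM from the decomp-res lens-4 g33 node `HOME/decomp-res-lens-4/g33/FactorCut.lean` (pin dd0f861c; NEW
part §99–§104 only; the node's carry of g32 rev 2 dropped in favour of `import …TauChainCutCells2`); HOME =
run/shared/lean/pub/decomp-res; critic row 191 CLEARED +1; landing orders INBOX :1049/:1051 — provenance, critic
text and the lens header in full in the first file of the node, `FactorCutKernels`.  Namespace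
`…Theorems.HugValuationCut`; `--supports stmt-ResolutionOfSingularities-28338`.

## This file

Continuation 2/2 of `FactorCutKernels` (same sections of the node, cut at the 400-line cap): carries
`FactorAt.principal_facIter`, `FactorAt.hugsGerm`, `FactorAt.isAbsContactAt_one`,
`regularSurfaceHugging_of_hugsGerm_span`, `hugsGerm_of_chain_absContact`, `contactHugging_of_chain_absContact`,
`regularSurfaceHugging_of_chain_absContact`, `FactorAt.contactHugging_of_absContact`,
`FactorAt.regularSurfaceHugging_of_absContact`, `FactorAt.regularSurfaceHugging_of_one`,
`FactorAt.isAbsContactAt_of_tame`, `FactorAt.isAbsContactAt_of_tame_perfect`, `FactorAt.contactHugging_of_tame`.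

[WRITER NOTE (decomp-res writer g12): file split only (tree files ≤ 400 lines); namespace, sections, section
variables / universes / opens and every declaration exactly as in the lens (the carry block and the node's global
dupNamespace-linter line are dropped — the library sets the latter; the two namespace-level `open
…AbsoluteContactClasses` / `open …Hironaka2005 (…)` lines of the new part are replayed in every file; the `open
…Theses` line and the lens's cone imports `MaxContactCutSatelliteCut` / `MaxContactCutWallCutCells` /
`MaxContactCutSurfacePort` live only in the Theses-cone file `MaxContactCutFactorCut`).]

(Sources: Hironaka1964 Ch. III; Giraud1975 (Giraud's lemma); Kollar2007 3.58–3.60; CossartJannsenSaito2020 Thm.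
6.40, Def. 6.38–6.39, Ch. 8; Hauser2010Kangaroo; HauserPerlega2019 §2; CossartPiltant2008 §2; CossartPiltant2019;
Hironaka2005 (three key theorems); EGAIV4 §16; Matsumura1987 §28; StacksProject 0804 / 0BIQ / 031I.)
-/

noncomputable section

open CategoryTheory AlgebraicGeometry IsLocalRing TopologicalSpace
open Literature.AlgebraicGeometry.Resolution
open Summit.ResolutionOfSingularities.ResolutionOfSingularities.Theorems
open WeakOrderReduction ForcedTowerClasses DivergentTowerClasses MonomialTowerClasses
open HugDimensionClasses HugDimensionKernels SurfaceShadowClasses SurfaceShadowKernels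
open NearPointCut (SingularClass)
open Scheme.IdealSheafData (vanishingIdeal)
open scoped BigOperators

namespace Summit.ResolutionOfSingularities.ResolutionOfSingularities.Theorems.HugValuationCut

open Summit.ResolutionOfSingularities.ResolutionOfSingularities.Theorems.AbsoluteContactClasses
  (IsAbsContactAt SepResidueAt AbsInv absInv_point sepResidueAt_of_perfectField)
open Literature.AlgebraicGeometry.Resolution.Hironaka2005 (le_idealOrder_of_mul_le le_idealOrder_of_mul_le')

section FactorChains

variable {k : Type} [Field k]

/-! ## §101 (g33 · NEW · KERNEL) PRINCIPAL FACTORS: PERSISTENCE, `strict = controlled`, AND THE HUGGING LAW -/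

/-- **principal factors stay principal and their strict and controlled chains have the same stalks** (KERNEL): if `H_{x_m}`
is principal then at every later marked point the weight-`a` controlled chain `facIter` has principal stalk, equal to the
stalk of the strict-transform chain `strictIter` (tree `IsBlowup.stalkIdeal_transforms_eq_span_of_isPrincipal` at each
step; the strict transform's stalk depends only on the stalk downstairs, tree `stalkIdeal_strictTransformIdeal`).
(Sources: Kollar2007, 3.58–3.60; Hironaka1964.) -/
theorem FactorAt.principal_facIter (T : ForcedTower) (g : T.St 0 ⟶ Spec (.of k)) (hB : IsBase (T.St 0) g) {n : ℕ}
    (hD : IsDatum n (T.D 0)) {m a b : ℕ} {H K : (T.St m).IdealSheafData} (hF : FactorAt T m a b H K)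
    (hP : (stalkIdeal H (T.pt m)).IsPrincipal) :
    ∀ j, (stalkIdeal (facIter T m a H j) (T.pt (m + j))).IsPrincipal ∧
      stalkIdeal (strictIter T m H j) (T.pt (m + j)) = stalkIdeal (facIter T m a H j) (T.pt (m + j)) := by
  intro j
  induction j with
  | zero => exact ⟨hP, rfl⟩
  | succ j ih =>
    show (stalkIdeal (facIter T m a H (j + 1)) (T.pt (m + j + 1))).IsPrincipal ∧
      stalkIdeal (strictIter T m H (j + 1)) (T.pt (m + j + 1)) = stalkIdeal (facIter T m a H (j + 1)) (T.pt (m + j + 1))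
    obtain ⟨hNi, hRi⟩ := tower_isLocallyNoetherian_isRegular T g hB (m + j)
    obtain ⟨hNi1, -⟩ := tower_isLocallyNoetherian_isRegular T g hB (m + j + 1)
    haveI := hNi
    haveI := hNi1
    have hπ := tower_isBlowup_vanishingIdeal T (m + j)
    have hreg : Scheme.IsRegular (vanishingIdeal ⟨{T.pt (m + j)}, T.isClosed_pt (m + j)⟩).subscheme := by
      rw [← tower_centre_eq_vanishingIdeal T (m + j)]
      exact T.centre_regular (m + j)
    have hx : (T.π (m + j)).base (T.pt (m + j + 1)) ∈
        ((⟨{T.pt (m + j)}, T.isClosed_pt (m + j)⟩ : Closeds (T.St (m + j))) : Set (T.St (m + j))) := by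
      rw [T.pt_map]
      exact Set.mem_singleton _
    have hYH : ∀ y ∈ ((⟨{T.pt (m + j)}, T.isClosed_pt (m + j)⟩ : Closeds (T.St (m + j))) : Set (T.St (m + j))),
        idealOrder (facIter T m a H j) y = a := by
      intro y hy
      have hy' : y = T.pt (m + j) := by simpa using hy
      rw [hy']
      exact (hF.forcing T g hB hD j).2.1
    have ih1 : (stalkIdeal (facIter T m a H j) ((T.π (m + j)).base (T.pt (m + j + 1)))).IsPrincipal := by
      rw [T.pt_map]
      exact ih.1
    have ih2 : stalkIdeal (strictIter T m H j) ((T.π (m + j)).base (T.pt (m + j + 1))) =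
        stalkIdeal (facIter T m a H j) ((T.π (m + j)).base (T.pt (m + j + 1))) := by
      rw [T.pt_map]
      exact ih.2
    obtain ⟨g', hcT, hsT⟩ := hπ.stalkIdeal_transforms_eq_span_of_isPrincipal hRi hreg hYH hx ih1
    refine ⟨?_, ?_⟩
    · rw [facIter_succ, tower_centre_eq_vanishingIdeal, hcT]
      infer_instance
    · show stalkIdeal (strictTransformIdeal (T.π (m + j)) (T.centre (m + j)) (strictIter T m H j)) _ =
        stalkIdeal (controlledTransform (T.π (m + j)) (T.centre (m + j)) (facIter T m a H j) a) _
      rw [tower_centre_eq_vanishingIdeal, hcT, ← hsT, stalkIdeal_strictTransformIdeal,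
        stalkIdeal_strictTransformIdeal, ih2]

/-- **THE HUGGING LAW** (KERNEL): a principal factor of positive weight is HUGGED by the marked points — its strict transforms
pass through every `x_{m+j}` (their stalks are the weight-`a` controlled chain, of order `a ≥ 1` there). [folklore] -/
theorem FactorAt.hugsGerm (T : ForcedTower) (g : T.St 0 ⟶ Spec (.of k)) (hB : IsBase (T.St 0) g) {n : ℕ}
    (hD : IsDatum n (T.D 0)) {m a b : ℕ} {H K : (T.St m).IdealSheafData} (hF : FactorAt T m a b H K) (ha : 1 ≤ a)
    (hP : (stalkIdeal H (T.pt m)).IsPrincipal) : HugsGerm T m H := by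
  refine ⟨by rw [hF.2.1]; exact ENat.coe_ne_top a, fun j => ?_⟩
  have h1 := (le_idealOrder_iff (facIter T m a H j) (T.pt (m + j)) 1).mp
    (by rw [(hF.forcing T g hB hD j).2.1]; exact_mod_cast ha)
  rw [pow_one] at h1
  refine (mem_support_iff_stalkIdeal_le _ _).mpr ?_
  rw [(hF.principal_facIter T g hB hD hP j).2]
  exact h1

/-- **a factor of order ONE is LATENT** — it carries an absolute contact element of its own weight `1` (any element of
`H_x ∖ 𝔪²`; weight `1` needs no derivative). [folklore] -/
theorem FactorAt.isAbsContactAt_one {T : ForcedTower} {i b : ℕ} {H K : (T.St i).IdealSheafData}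
    (hF : FactorAt T i 1 b H K) : IsAbsContactAt H 1 (T.pt i) := by
  have h1 : stalkIdeal H (T.pt i) ≤ maximalIdeal _ := by
    have h := (le_idealOrder_iff H _ 1).mp hF.2.1.ge
    rw [pow_one] at h
    exact h
  have h2 : ¬ stalkIdeal H (T.pt i) ≤ maximalIdeal _ ^ 2 := by
    rw [← le_idealOrder_iff, hF.2.1]
    exact fun h => absurd (ENat.coe_le_coe.mp h) (by omega)
  obtain ⟨u, huH, hu2⟩ := SetLike.not_le_iff_exists.mp h2
  exact ⟨u, le_diffIdeal ℤ 0 _ huH, h1 huH, hu2⟩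

/-- a hugged germ whose stalk at `x_m` is generated by a regular parameter of the three-dimensional regular local ring
`𝒪_{x_m}` is a REGULAR SURFACE germ hugged by the tower. (Sources: Matsumura1987, Thm. 14.2.) -/
theorem regularSurfaceHugging_of_hugsGerm_span {T : ForcedTower} {m : ℕ} {Z : (T.St m).IdealSheafData}
    [IsRegularLocalRing ((T.St m).presheaf.stalk (T.pt m))]
    (hd : ringKrullDim ((T.St m).presheaf.stalk (T.pt m)) = 3) {u : (T.St m).presheaf.stalk (T.pt m)}
    (hZ : stalkIdeal Z (T.pt m) = Ideal.span {u}) (hu : u ∈ maximalIdeal _) (hu2 : u ∉ maximalIdeal _ ^ 2)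
    (hh : HugsGerm T m Z) : RegularSurfaceHugging T := by
  obtain ⟨hreg, h2⟩ := isRegularLocalRing_quotient_of_dim_three hd hu hu2
  exact ⟨m, Z, hh, by rw [hZ]; exact h2, by rw [hZ]; exact hreg⟩

/-! ## §102 (g33 · NEW · KERNEL) THE GENERAL TRANSPORT ENGINE — GIRAUD'S LEMMA ALONG ANY IDEAL CHAIN — AND THE LATENT-FACTOR
KILL

g21/g22 transported an absolute contact element of THE MARKED IDEAL along the tower. The engine below transports an absolute
contact element of ANY chain of ideal sheaves `J_i` on the stages `m + i` that (1) has order `≥ N + 1` at every marked point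
and (2) grows at least as fast as its weight-`(N+1)` controlled transform at the marked points
(`(π⁻¹J_i : E^{N+1})_{x} ≤ (J_{i+1})_{x}`). A FACTOR CHAIN `facIter` of weight `a = N + 1` is such a chain (forcing law), and
so is the marked chain itself. -/

/-- **THE TRANSPORT ENGINE** (KERNEL, hypothesis-free): an absolute contact element `u ∈ Diff^{N}_ℤ(J_{0,x_m}) ∖ 𝔪²` of a
chain as above spreads (Macaulayfication centre-spread) to an ideal sheaf `Z ∋` with `Z_{x_m} = (u)`, and Giraud's lemma
(tree `absInv_point`) carries the invariant «`Z^{st}_{x} = (z)`, `z ∈ Diff^N_ℤ(J_{i,x}) ∩ (𝔪 ∖ 𝔪²)`» up the tower — so the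
regular hypersurface germ `Z` is HUGGED by every marked point. (Sources: Giraud1975; EncinasVillamayor2000, Thm. 4.9;
CossartJannsenSaito2020, Lem. 9.2.) -/
theorem hugsGerm_of_chain_absContact (T : ForcedTower) (g : T.St 0 ⟶ Spec (.of k)) (hB : IsBase (T.St 0) g)
    (M N : ℕ) (J : (i : ℕ) → (T.St (M + i)).IdealSheafData)
    (hJ1 : ∀ i, stalkIdeal (J i) (T.pt (M + i)) ≤ maximalIdeal _ ^ (N + 1))
    (hJ2 : ∀ i, stalkIdeal (controlledTransform (T.π (M + i)) (T.centre (M + i)) (J i) (N + 1)) (T.pt (M + i + 1)) ≤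
      stalkIdeal (J (i + 1)) (T.pt (M + i + 1)))
    (habs : IsAbsContactAt (J 0) (N + 1) (T.pt M)) :
    ∃ (Z : (T.St M).IdealSheafData) (u : (T.St M).presheaf.stalk (T.pt M)),
      stalkIdeal Z (T.pt M) = Ideal.span {u} ∧ u ∈ maximalIdeal _ ∧ u ∉ maximalIdeal _ ^ 2 ∧ HugsGerm T M Z := by
  obtain ⟨u, hu, hum, hu2⟩ := habs
  rw [Nat.add_sub_cancel] at hu
  haveI := tower_isNoetherian T g hB M
  have hu0 : u ≠ 0 := fun h => hu2 (by rw [h]; exact zero_mem _)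
  obtain ⟨Z, -, -, hZst⟩ := FInjectiveMacaulayfication.CentreSpread.centreSpread (T.St M) (T.pt M) 1 (fun _ => u)
      (by rw [Set.range_const, Ne, Ideal.span_singleton_eq_bot]; exact hu0)
      (by rw [Set.range_const]; exact (Ideal.span_singleton_le_iff_mem _).mpr hum)
  rw [Set.range_const] at hZst
  have hinv : ∀ i, AbsInv (J i) (strictIter T M Z i) N (T.pt (M + i)) := by
    intro i
    induction i with
    | zero => exact ⟨u, hZst, hu, hum, hu2⟩
    | succ i ih =>
      show AbsInv (J (i + 1)) (strictIter T M Z (i + 1)) N (T.pt (M + i + 1))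
      obtain ⟨hNi, hRi⟩ := tower_isLocallyNoetherian_isRegular T g hB (M + i)
      obtain ⟨hNi1, -⟩ := tower_isLocallyNoetherian_isRegular T g hB (M + i + 1)
      haveI := hNi
      haveI := hNi1
      have hy : (T.π (M + i)).base (T.pt (M + i + 1)) = T.pt (M + i) := T.pt_map (M + i)
      have h' : AbsInv (J i) (strictIter T M Z i) N ((T.π (M + i)).base (T.pt (M + i + 1))) := by
        rw [hy]
        exact ih
      have hIn : stalkIdeal (J i) ((T.π (M + i)).base (T.pt (M + i + 1))) ≤ maximalIdeal _ ^ (N + 1) := by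
        rw [hy]
        exact hJ1 i
      have hI'n : stalkIdeal (controlledTransform (T.π (M + i)) (T.centre (M + i)) (J i) (N + 1)) (T.pt (M + i + 1)) ≤
          maximalIdeal _ ^ (N + 1) := (hJ2 i).trans (hJ1 (i + 1))
      have hpt' : ((T.centre (M + i)).support : Set (T.St (M + i))) = {(T.π (M + i)).base (T.pt (M + i + 1))} := by
        rw [hy]
        exact T.centre_support (M + i)
      have hcl : IsClosed ({(T.π (M + i)).base (T.pt (M + i + 1))} : Set (T.St (M + i))) := by
        rw [hy]
        exact T.isClosed_pt (M + i)
      obtain ⟨z, hHz, hzD, hz1, hz2⟩ :=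
        absInv_point (T.isBlowup (M + i)) hRi (T.centre_regular (M + i)) _ (strictIter T M Z i) N _ hcl hpt' hIn hI'n h'
      exact ⟨z, hHz, diffIdeal_mono ℤ N (hJ2 i) hzD, hz1, hz2⟩
  refine ⟨Z, u, hZst, hum, hu2, ?_, fun i => ?_⟩
  · intro htop
    have hle : stalkIdeal Z (T.pt M) ≤ maximalIdeal _ ^ 2 :=
      (le_idealOrder_iff Z _ 2).mp (by rw [htop]; exact le_top)
    rw [hZst] at hle
    exact hu2 (hle (Ideal.mem_span_singleton_self u))
  · obtain ⟨z, hHz, -, hzm, -⟩ := hinv i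
    exact (mem_support_iff_stalkIdeal_le _ _).mpr (by rw [hHz]; exact (Ideal.span_singleton_le_iff_mem _).mpr hzm)

/-- **the engine, contact form**: the hugged germ has order `1` at `x_M`, so the tower is CONTACT. [folklore] -/
theorem contactHugging_of_chain_absContact (T : ForcedTower) (g : T.St 0 ⟶ Spec (.of k)) (hB : IsBase (T.St 0) g)
    (M N : ℕ) (J : (i : ℕ) → (T.St (M + i)).IdealSheafData)
    (hJ1 : ∀ i, stalkIdeal (J i) (T.pt (M + i)) ≤ maximalIdeal _ ^ (N + 1))
    (hJ2 : ∀ i, stalkIdeal (controlledTransform (T.π (M + i)) (T.centre (M + i)) (J i) (N + 1)) (T.pt (M + i + 1)) ≤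
      stalkIdeal (J (i + 1)) (T.pt (M + i + 1)))
    (habs : IsAbsContactAt (J 0) (N + 1) (T.pt M)) : ContactHugging T := by
  obtain ⟨Z, u, hZ, hum, hu2, hh⟩ := hugsGerm_of_chain_absContact T g hB M N J hJ1 hJ2 habs
  refine ⟨M, Z, le_antisymm ?_ ?_, hh⟩
  · by_contra hlt
    rw [not_le] at hlt
    have h2 : ((2 : ℕ) : ℕ∞) ≤ idealOrder Z (T.pt M) := by
      have : (1 : ℕ∞) + 1 ≤ idealOrder Z (T.pt M) := (ENat.add_one_le_iff (ENat.coe_ne_top 1)).mpr hlt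
      exact_mod_cast this
    rw [le_idealOrder_iff, hZ] at h2
    exact hu2 (h2 (Ideal.mem_span_singleton_self u))
  · rw [show (1 : ℕ∞) = ((1 : ℕ) : ℕ∞) from rfl, le_idealOrder_iff, hZ, pow_one]
    exact (Ideal.span_singleton_le_iff_mem _).mpr hum

/-- **the engine, regular-surface form**: if `𝒪_{x_M}` has dimension `3` the hugged germ `V(Z)` is a REGULAR SURFACE germ
hugged by the tower. (Sources: Matsumura1987, Thm. 14.2; Giraud1975.) -/
theorem regularSurfaceHugging_of_chain_absContact (T : ForcedTower) (g : T.St 0 ⟶ Spec (.of k))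
    (hB : IsBase (T.St 0) g) (M N : ℕ) (J : (i : ℕ) → (T.St (M + i)).IdealSheafData)
    (hJ1 : ∀ i, stalkIdeal (J i) (T.pt (M + i)) ≤ maximalIdeal _ ^ (N + 1))
    (hJ2 : ∀ i, stalkIdeal (controlledTransform (T.π (M + i)) (T.centre (M + i)) (J i) (N + 1)) (T.pt (M + i + 1)) ≤
      stalkIdeal (J (i + 1)) (T.pt (M + i + 1)))
    (habs : IsAbsContactAt (J 0) (N + 1) (T.pt M)) (hd : ringKrullDim ((T.St M).presheaf.stalk (T.pt M)) = 3) :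
    RegularSurfaceHugging T := by
  haveI : IsRegularLocalRing ((T.St M).presheaf.stalk (T.pt M)) :=
    (tower_isLocallyNoetherian_isRegular T g hB M).2 (T.pt M)
  obtain ⟨Z, u, hZ, hum, hu2, hh⟩ := hugsGerm_of_chain_absContact T g hB M N J hJ1 hJ2 habs
  exact regularSurfaceHugging_of_hugsGerm_span hd hZ hum hu2 hh

/-- **THE LATENT-FACTOR KILL, contact form** (KERNEL): a factorization whose factor `H` of weight `a = N + 1` carries an
absolute contact element of ITS OWN weight at `x_m` makes the tower CONTACT — the engine runs along the weight-`a` factor chain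
(`hJ1` = the forcing law, `hJ2` = equality). This is absolute contact of order `a − 1 < n − 1` for the marked ideal: invisible
to the marked weight, visible to the factor. (Sources: Giraud1975; EncinasVillamayor2000, Thm. 4.9; CossartPiltant2008,
Prop. 4.2.) -/
theorem FactorAt.contactHugging_of_absContact (T : ForcedTower) (g : T.St 0 ⟶ Spec (.of k)) (hB : IsBase (T.St 0) g)
    {n : ℕ} (hD : IsDatum n (T.D 0)) {m N b : ℕ} {H K : (T.St m).IdealSheafData} (hF : FactorAt T m (N + 1) b H K)
    (habs : IsAbsContactAt H (N + 1) (T.pt m)) : ContactHugging T :=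
  contactHugging_of_chain_absContact T g hB m N (fun i => facIter T m (N + 1) H i)
    (fun i => (le_idealOrder_iff _ _ (N + 1)).mp (hF.forcing T g hB hD i).2.1.ge) (fun _ => le_rfl) habs

/-- **THE LATENT-FACTOR KILL, regular-surface form** (KERNEL): the same in ring dimension `3` at `x_m` gives a REGULAR SURFACE
germ hugged by the tower — contradicting `SingularClass`. (Sources: Giraud1975; Matsumura1987, Thm. 14.2.) -/
theorem FactorAt.regularSurfaceHugging_of_absContact (T : ForcedTower) (g : T.St 0 ⟶ Spec (.of k))
    (hB : IsBase (T.St 0) g) {n : ℕ} (hD : IsDatum n (T.D 0)) {m N b : ℕ} {H K : (T.St m).IdealSheafData}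
    (hF : FactorAt T m (N + 1) b H K) (habs : IsAbsContactAt H (N + 1) (T.pt m))
    (hd : ringKrullDim ((T.St m).presheaf.stalk (T.pt m)) = 3) : RegularSurfaceHugging T :=
  regularSurfaceHugging_of_chain_absContact T g hB m N (fun i => facIter T m (N + 1) H i)
    (fun i => (le_idealOrder_iff _ _ (N + 1)).mp (hF.forcing T g hB hD i).2.1.ge) (fun _ => le_rfl) habs hd

/-- **THE DIVISORIAL KILL in ring dimension 3** (KERNEL): a PRINCIPAL factor of weight `a ≥ 1` generated by a regular
parameter (`a = 1`) is a regular surface germ hugged by the tower. [folklore] -/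
theorem FactorAt.regularSurfaceHugging_of_one (T : ForcedTower) (g : T.St 0 ⟶ Spec (.of k)) (hB : IsBase (T.St 0) g)
    {n : ℕ} (hD : IsDatum n (T.D 0)) {m b : ℕ} {H K : (T.St m).IdealSheafData} (hF : FactorAt T m 1 b H K)
    (hd : ringKrullDim ((T.St m).presheaf.stalk (T.pt m)) = 3) : RegularSurfaceHugging T :=
  hF.regularSurfaceHugging_of_absContact T g hB hD (N := 0) hF.isAbsContactAt_one hd

/-- **TAME FACTORS ARE LATENT** (KERNEL): a factor of weight `a` prime to the characteristic at a point with separable residue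
field carries an absolute contact element of weight `a` (g21 `isAbsContactAt_of_tame_sep` on the stage `T.St m`, a base by
`tower_isBase`). (Sources: EGAIV4, Thm. 16.11.2; Giraud1975; EncinasVillamayor2000, Thm. 4.9.) -/
theorem FactorAt.isAbsContactAt_of_tame {p : ℕ} (hp : p.Prime) [CharP k p] (T : ForcedTower)
    (g : T.St 0 ⟶ Spec (.of k)) (hB : IsBase (T.St 0) g) {m a b : ℕ} {H K : (T.St m).IdealSheafData}
    (hF : FactorAt T m a b H K) (hpa : ¬ p ∣ a) (hsep : SepResidueAt (toRoot T m ≫ g) (T.pt m)) :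
    IsAbsContactAt H a (T.pt m) :=
  isAbsContactAt_of_tame_sep hp (toRoot T m ≫ g) (tower_isBase T g hB m) H (T.isClosed_pt m) hsep hF.2.1 hpa

/-- over a PERFECT ground field every marked point has separable residue field, so every factor of weight prime to `p` is
latent. (Sources: EGAIV4, Thm. 16.11.2; Giraud1975.) -/
theorem FactorAt.isAbsContactAt_of_tame_perfect {p : ℕ} (hp : p.Prime) [CharP k p] [PerfectField k] (T : ForcedTower)
    (g : T.St 0 ⟶ Spec (.of k)) (hB : IsBase (T.St 0) g) {m a b : ℕ} {H K : (T.St m).IdealSheafData}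
    (hF : FactorAt T m a b H K) (hpa : ¬ p ∣ a) : IsAbsContactAt H a (T.pt m) :=
  haveI : LocallyOfFiniteType (toRoot T m ≫ g) := (tower_isBase T g hB m).locallyOfFiniteType
  hF.isAbsContactAt_of_tame hp T g hB hpa (sepResidueAt_of_perfectField (toRoot T m ≫ g) (T.isClosed_pt m))

/-- **THE TAME-FACTOR KILL** (KERNEL): a factor of positive weight prime to `p` at a point with separable residue field makes
the tower CONTACT. (Sources: Giraud1975; EncinasVillamayor2000, Thm. 4.9.) -/
theorem FactorAt.contactHugging_of_tame {p : ℕ} (hp : p.Prime) [CharP k p] (T : ForcedTower)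
    (g : T.St 0 ⟶ Spec (.of k)) (hB : IsBase (T.St 0) g) {n : ℕ} (hD : IsDatum n (T.D 0)) {m a b : ℕ}
    {H K : (T.St m).IdealSheafData} (hF : FactorAt T m a b H K) (ha : 1 ≤ a) (hpa : ¬ p ∣ a)
    (hsep : SepResidueAt (toRoot T m ≫ g) (T.pt m)) : ContactHugging T := by
  obtain ⟨N, rfl⟩ : ∃ N, a = N + 1 := ⟨a - 1, by omega⟩
  exact hF.contactHugging_of_absContact T g hB hD (hF.isAbsContactAt_of_tame hp T g hB hpa hsep)

end FactorChains

end Summit.ResolutionOfSingularities.ResolutionOfSingularities.Theorems.HugValuationCut
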